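import Summits.ValiantsHypothesis.ValiantsHypothesis.Theorems.GrenetZeonDualUnipotentThreeHalvesSlowCoreLedger

set_option linter.dupNamespace false
set_option autoImplicit false
noncomputable section
namespace Summit.ValiantsHypothesis.ValiantsHypothesis.Theorems.GrenetZeon.SlowCore.RowR7Probe
open Summit.ValiantsHypothesis.ValiantsHypothesis.Cruxes.TwoDimCoefficients.DimTwoCases (AffMat IsAffine)
open Summit.ValiantsHypothesis.ValiantsHypothesis.Theorems.GrenetZeon.SlowCore (RelCert LevelCut)

/-- r7 (crit-7 V35 Lemma P), signature probe: STRICT level cut (acyclic support, edges drop in level) ⇒ price ≤ 20·√n·b. -/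
theorem relCert_of_acyclicSupport {n b : ℕ} (B : AffMat n b) (hB : IsAffine B) (lvl : Fin b → ℕ)
    (hlvl : ∀ i j, B i j ≠ 0 → lvl j < lvl i) : RelCert n b B (20 * (Nat.sqrt n * b)) := by
  sorry

/-- sanity: the strict cut implies the line's `LevelCut`. -/
example {n b : ℕ} (B : AffMat n b) (lvl : Fin b → ℕ) (hlvl : ∀ i j, B i j ≠ 0 → lvl j < lvl i) : LevelCut B lvl := by
  intro i j hij
  by_contra h
  exact absurd (hlvl i j h) (by omega)

end Summit.ValiantsHypothesis.ValiantsHypothesis.Theorems.GrenetZeon.SlowCore.RowR7Probe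
end
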